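import Mathlib
import Literature.MathematicalPhysics.QuantumFieldTheory.Balaban1983to89.TreeLengthCubeSystem

/-!
# `Balaban1983to89.B13Geometry236` — [Balaban1988RG2Cluster] p. 19, the scale-transfer inequality (2.36)
"2d_k(Z_i) ≧ Ld_{k+1}(Z′_i)": the cell's certified substitute PROVED IN THE KERNEL for the formalised tree length
`treeLen`, in every dimension d and for every block size L ≥ 3, with the factor a(L) = 3 + 4/(L − 2) and NO additive
constant

CITATION HEADER (lean-in-tree rule 2026-08-18).  Source under audit: T. Bałaban, *Renormalization group approach to
lattice gauge field theories. II. Cluster expansions*, Commun. Math. Phys. **116**, 1–22 (1988), doi:10.1007/bf01239022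
[Balaban1988RG2Cluster] (cell paper B13; PDF held `paper:balaban1988-cmp116-rg-ii-cluster`, journal page = PDF page;
the sentences of p. 19 repeated below are quoted — and were render-checked — in the sibling modules
`…Balaban1983to89.B13` Part F and `…Balaban1983to89.B13ScaleTransfer`), together with the definitions of
[Balaban1987RG1] = part I, Commun. Math. Phys. **109** (1987) p. 257 (cubes, X̃, the linear size d_j), formalised by
unit pv22 in `…Balaban1983to89.TreeLength` (`treeLen`: connected polygonal graphs, closed unit cubes, Mathlib's sup
metric on ℝ^d = the convention of [Dimock2013BalabanII] App. E; cell DIVERGENCE D-T2, D-pv22.1).  What is proved here is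
NOT a statement of the audited papers: it is the cell's own elementary substitute for the unproved printed step (2.36)
(cell GAPS.md G-B13-09 / G-B13-09R / C-B13-09; prose version with a weaker constant: `HOME/b2b-balaban-b13/GEOMETRY-236.md`,
unit b2b-balaban-b13-g2, Theorem A / Corollary B, a(L) = 3 + 12/(L − 2), d = 4), now a kernel theorem about pv22's
`treeLen` with a(L) = 3 + 4/(L − 2), all d.  Imports `…TreeLengthCubeSystem` (unit pv22; for the concrete window
systems of Part 6) and through it `…TreeLength`, `…B13ScaleTransfer` (unit pv11: the index model `Pt`, `collar` = X̃,
`coarse`, `closureIdx` = Z ↦ Z′, `ScaleTransfer`), `…B13` (unit b13: `Ineq236With`, `Consts.aL`); nothing existing is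
modified.  Unit `b2b-balaban-pv11-g2` (surge node prover #11, gen 2), journal claim G-B13-09-GEOM236-KERNEL.

WHAT THE PAPER PRINTS (p. 19 [PDF 19], verbatim, as quoted in `…B13ScaleTransfer`): *"The remaining exponential is
bounded using the following inequality: 2d_k(Z_i) ≧ Ld_{k+1}(Z′_i). (2.36) This inequality can be obtained by simple,
but awkward, geometric and combinatoric considerations. It follows by considering locally many possible cases."*, where
(p. 19) *"we denote by Z′_i the smallest localization domain from 𝐃_{k+1} containing Z̃_i"*.  In the index model:
Z ⊂ ℤ^d non-empty and face-connected (a localization domain from 𝐃_k, unit cubes), Z̃ = `collar Z`, Z′ = `closureIdx L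
(collar Z)` (index set of the π_{k+1}-cubes met by Z̃, rescaled to unit cubes by p ↦ p/L), d_k = `treeLen`.

WHAT IS PROVED HERE (kernel-checked, zero `sorry`; every input is a theorem of the imported modules or of Mathlib).
MAIN THEOREM `geometry236_treeLen`: for every d, every L ≥ 3 and every non-empty face-connected Z,
  L · treeLen(Z′) ≤ (3 + 4/(L − 2)) · treeLen(Z).
Equivalently `scaleTransfer_treeLen_geometry : ScaleTransfer d L treeLen (a236 L) 0` (pv11's shape, additive constant
0), sharper than both kernel predecessors `TreeLength.scaleTransfer_treeLen` (A_d = 1 + 8(3^d − 1)(2^d + 1), B_d > 0)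
/ `scaleTransfer_treeLen_four` (5121, 1280) and than the prose constant of GEOMETRY-236.md (`a236_le_aL`:
3 + 4/(L − 2) ≤ `B13.Consts.aL L` = 3 + 12/(L − 2)); d = 4, L = 13: 13 · d_{k+1}(Z′) ≤ (37/11) · d_k(Z)
(`geometry236_thirteen`), transfer factor ℓ = L/a(L) = 143/37 = 3.86… (`transferFactor_thirteen`; printed ½L = 6.5;
prose 143/45).  The transfer factor exceeds 1 iff a(L) < L iff L ≥ 5 for integer L (`one_lt_transferFactor`,
`a236_lt_self`), so the p. 21 closing assumption in the form `(1 − 10δ)·ℓ = 1` (`B13.Consts.R22gen`) has a solution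
δ ∈ (0, 1/10) for every L admitted by [Balaban1987RG1] p. 251 ("L is an odd, positive integer > 11").  Part 6: for pv22's
concrete window systems `TreeLengthCubeSystem.sys B` the transfer inequality `B13.Ineq236With (sys B_k) (sys B_{k+1})
(Z ↦ Z′) (L / a236 L)` is a THEOREM (`ineq236With_window`), i.e. the transfer input behind Lemma 3_ℓ
(`B13.exp_transfer_of_ineq236With`; ℓ is the parameter of `B13.Lemma3With`, `B13.Consts.R22gen`,
`B13.deliverables_of_chainWith`, `B13Closing.deliverables_window`) holds at ℓ = L/a236 L for that carrier.

THE PROOF (elementary; it replaces the tree cutting / tree median of the prose Theorem A by a separated net and the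
sup-metric geometry of unit cubes).  Fix an admissible graph T for Z and rescale it by 1/L (pv22's `admissible_scale`:
an admissible graph T₁ for the π_{k+1}-cubes met by Z, |T₁| = |T|/L).  (1) "Two scales apart" (`sub_two_le_len`, the
prose Lemma 1): if two cells of Z′ are ≥ 2 apart in some coordinate, T contains two points ≥ L − 2 apart, so
|T| ≥ L − 2 by pv22's capture lemma `le_lenIn_closedBall`; otherwise all cells of Z′ have a common point and
treeLen(Z′) = 0 (`exists_common_point`, `admissible_point`).  (2) Every cell c of Z′ contains a point within 1/L of the
rescaled witness point p_z ∈ T₁ of some cube z of Z (`exists_corner_point`: c comes from a cube y of Z̃ touching a cube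
z of Z; take the common corner of y and z).  (3) Pick r > 0 with 4r + 2/L < 1 and a maximal subfamily S of cubes of Z
whose points p_s are pairwise > 2r apart: every p_z is within 2r of some p_s, and if |S| ≥ 2 the disjoint balls
B̄(p_s, r) each capture length ≥ r of T₁, so |S|·r ≤ |T|/L (the net argument of pv22's `card_le_of_sAdmissible`).
(4) WHISKERS: at each p_s hang the segment to the point f_s obtained by rounding every coordinate of p_s that is within
R := 2r + 1/L < ½ of an integer to that integer (`snap`); |f_s − p_s|_∞ ≤ R, and EVERY closed unit cube containing a
point within R of p_s contains f_s (`snap_mem_cube` — this is where the sup metric and 2R < 1 are used).  By (2) and the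
cover property every cell of Z′ contains such a point, so T₁ plus the |S| whiskers is admissible for Z′
(`exists_admissible_closure`), of length ≤ |T|/L + |S|·R.  (5) Accounting: L·|S|·R = |S|(2rL + 1) ≤ 2|T| + |T|/(rL)
if |S| ≥ 2, and ≤ 2rL + 1 < L/2 ≤ 2|T| if |S| ≤ 1 (by (1)); so L·treeLen(Z′) ≤ (3 + 1/(rL))·|T| for every admissible
T and every rL < (L − 2)/4, whence the theorem (`le_mul_treeLen`, r ↑ (L − 2)/(4L)).

WHAT IS *NOT* CLAIMED.  (i) The printed (2.36) itself (factor exactly ½L): it stays UNPROVED in print, false for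
L ≤ 5 (cell G-B13-09 (i)) and undecided for the L in force; it is not needed (ℓ > 1 suffices for pp. 19–21,
`B13.Consts.delta_pos_iff_of_R22gen`).  (ii) Only the sup-metric tree length is treated (the kernel object `treeLen`;
the prose GEOMETRY-236.md covers ℓ¹/ℓ² with its constants).  (iii) `treeLen` carries pv22's conventions D-pv22.1
(connected polygonal graphs rather than trees — same infimum —, free boundary, no torus wrap-around).  (iv) Nothing
about Lemma 3 or the series.  Value = kernel certificate of a located-gap repair, NOT summit progress.
-/

namespace Literature.MathematicalPhysics.QuantumFieldTheory.Balaban1983to89.B13Geometry236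

noncomputable section

open Literature.MathematicalPhysics.QuantumFieldTheory.Balaban1983to89
open Literature.MathematicalPhysics.QuantumFieldTheory.Balaban1983to89.B13ScaleTransfer
open Literature.MathematicalPhysics.QuantumFieldTheory.Balaban1983to89.TreeLength
open MeasureTheory

variable {d : ℕ}

/-! ## Part 1. Complements on pv22's polygonal graphs -/

/-- The length of a graph inside any region is at most its length. [folklore] -/
theorem lenIn_le_len (B : Set (RPt d)) (T : List (Seg d)) : lenIn B T ≤ len T := by
  induction T with
  | nil => simp
  | cons s T ih =>
    rw [lenIn_cons, len_cons]
    have h1 : (volume (paramIn B s)).toReal ≤ 1 :=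
      ENNReal.toReal_le_of_le_ofReal zero_le_one (by rw [ENNReal.ofReal_one]; exact volume_paramIn_le_one B s)
    have h2 := mul_le_mul_of_nonneg_left h1 (dist_nonneg : 0 ≤ dist s.1 s.2)
    rw [mul_one] at h2
    linarith

/-- A graph made of n segments each of length ≤ R has length ≤ n·R. [folklore] -/
theorem len_map_le {ι : Type*} (l : List ι) (F : ι → Seg d) {R : ℝ}
    (h : ∀ i ∈ l, dist (F i).1 (F i).2 ≤ R) : len (l.map F) ≤ (l.length : ℝ) * R := by
  induction l with
  | nil => simp
  | cons i l ih =>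
    rw [List.map_cons, len_cons, List.length_cons]
    have h1 : dist (F i).1 (F i).2 ≤ R := h i (by simp)
    have h2 := ih fun j hj => h j (by simp [hj])
    push_cast
    linarith

/-- Hanging segments ("whiskers") on a connected set keeps it connected: if every segment of W has its first endpoint
in the connected set A, then A ∪ (carrier W) is connected. [folklore] -/
theorem isConnected_union_carrier {A : Set (RPt d)} (hA : IsConnected A) (W : List (Seg d))
    (hW : ∀ s ∈ W, s.1 ∈ A) : IsConnected (A ∪ carrier W) := by
  induction W with
  | nil => simpa using hA
  | cons s W ih =>
    have ih' := ih fun s' hs' => hW s' (by simp [hs'])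
    have hs : s.1 ∈ A := hW s (by simp)
    rw [carrier_cons, Set.union_left_comm]
    exact IsConnected.union ⟨s.1, left_mem_segment ℝ s.1 s.2, Or.inl hs⟩
      ((convex_segment s.1 s.2).isConnected ⟨s.1, left_mem_segment ℝ s.1 s.2⟩) ih'

/-- The one-point graph at a point common to all cubes of X is admissible for X (length 0) — the "one-point tree" of
GEOMETRY-236.md Lemma 1. [folklore] -/
theorem admissible_point {X : Finset (Pt d)} (hX : X.Nonempty) {q : RPt d} (hq : ∀ c ∈ X, q ∈ cube c) :
    Admissible X [(q, q)] := by
  have hc : carrier [(q, q)] = {q} := by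
    simp only [carrier_cons, carrier_nil, Set.union_empty, segment_same]
  refine ⟨?_, ?_, ?_⟩
  · rw [hc]
    exact isConnected_singleton
  · rw [hc, Set.singleton_subset_iff]
    obtain ⟨c, hcX⟩ := hX
    exact cube_subset_cubes hcX (hq c hcX)
  · intro c hcX
    exact ⟨q, by rw [hc]; exact Set.mem_singleton q, hq c hcX⟩

/-- HELLY FOR UNIT CUBES OF THE GRID (GEOMETRY-236.md Lemma 1, first half): if the cubes of X pairwise touch — indices
differ by at most 1 in every coordinate — then they have a common point (coordinatewise the largest index). [folklore] -/
theorem exists_common_point {X : Finset (Pt d)} (hX : X.Nonempty)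
    (h : ∀ c₁ ∈ X, ∀ c₂ ∈ X, ∀ μ, c₂ μ ≤ c₁ μ + 1) : ∃ q : RPt d, ∀ c ∈ X, q ∈ cube c := by
  refine ⟨fun μ => ((X.sup' hX fun c => c μ : ℤ) : ℝ), fun c hc => mem_cube.2 fun μ => ⟨?_, ?_⟩⟩
  · have h1 : c μ ≤ X.sup' hX (fun c => c μ) := Finset.le_sup' (fun c => c μ) hc
    exact_mod_cast h1
  · have h2 : X.sup' hX (fun c => c μ) ≤ c μ + 1 := Finset.sup'_le hX _ fun c₂ hc₂ => h c hc c₂ hc₂ μ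
    exact_mod_cast h2

/-- Passing to the infimum with a multiplicative constant: if `a ≤ K·|T|` for every admissible graph T of X (K ≥ 0,
the class non-empty) then `a ≤ K·treeLen X`. [folklore] -/
theorem le_mul_treeLen {X : Finset (Pt d)} {a K : ℝ} (hK : 0 ≤ K) (hne : ∃ T, Admissible X T)
    (h : ∀ T, Admissible X T → a ≤ K * len T) : a ≤ K * treeLen X := by
  rcases hK.eq_or_lt with rfl | hK'
  · obtain ⟨T, hT⟩ := hne
    have := h T hT
    rw [zero_mul] at this ⊢
    exact this
  · have h' : a / K ≤ treeLen X := le_treeLen hne fun T hT => by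
      rw [div_le_iff₀ hK']
      linarith [h T hT, mul_comm K (len T)]
    rwa [div_le_iff₀ hK', mul_comm] at h'

/-! ## Part 2. Rounding a point to the nearby grid hyperplanes (the whisker endpoints; sup metric) -/

/-- One coordinate of the whisker endpoint: round `a` down to ⌊a⌋ if within R of it, else up to ⌈a⌉ if within R of
it, else keep `a`. [folklore] -/
def snap1 (R a : ℝ) : ℝ :=
  if a - ⌊a⌋ ≤ R then (⌊a⌋ : ℝ) else if (⌈a⌉ : ℝ) - a ≤ R then (⌈a⌉ : ℝ) else a

/-- The rounded coordinate is within R of the original one (R ≥ 0). [folklore] -/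
theorem abs_snap1_sub_le {R : ℝ} (hR : 0 ≤ R) (a : ℝ) : |snap1 R a - a| ≤ R := by
  unfold snap1
  split_ifs with h1 h2
  · rw [abs_sub_comm, abs_of_nonneg (sub_nonneg.2 (Int.floor_le a))]
    exact h1
  · rw [abs_of_nonneg (sub_nonneg.2 (Int.le_ceil a))]
    exact h2
  · rw [sub_self, abs_zero]
    exact hR

/-- KEY ONE-DIMENSIONAL FACT (needs 2R < 1): every unit interval [n, n + 1] containing a point q within R of a contains
the rounded coordinate `snap1 R a`. [folklore] -/
theorem snap1_mem {R : ℝ} (h2R : 2 * R < 1) {a q : ℝ} {n : ℤ} (hq1 : (n : ℝ) ≤ q) (hq2 : q ≤ (n : ℝ) + 1)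
    (hqa : |q - a| ≤ R) : (n : ℝ) ≤ snap1 R a ∧ snap1 R a ≤ (n : ℝ) + 1 := by
  have hR : 0 ≤ R := (abs_nonneg _).trans hqa
  rw [abs_le] at hqa
  obtain ⟨hqa1, hqa2⟩ := hqa
  have hfl := Int.floor_le a
  have hce := Int.le_ceil a
  unfold snap1
  split_ifs with h1 h2
  · constructor
    · have h : (n : ℝ) < (⌊a⌋ : ℝ) + 1 := by linarith
      have h' : n < ⌊a⌋ + 1 := by exact_mod_cast h
      have h'' : n ≤ ⌊a⌋ := by omega
      exact_mod_cast h''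
    · have h : (⌊a⌋ : ℝ) < (n : ℝ) + 2 := by linarith
      have h' : ⌊a⌋ < n + 2 := by exact_mod_cast h
      have h'' : ⌊a⌋ ≤ n + 1 := by omega
      exact_mod_cast h''
  · constructor
    · have h : (n : ℝ) < (⌈a⌉ : ℝ) + 1 := by linarith
      have h' : n < ⌈a⌉ + 1 := by exact_mod_cast h
      have h'' : n ≤ ⌈a⌉ := by omega
      exact_mod_cast h''
    · have h : (⌈a⌉ : ℝ) < (n : ℝ) + 2 := by linarith
      have h' : ⌈a⌉ < n + 2 := by exact_mod_cast h
      have h'' : ⌈a⌉ ≤ n + 1 := by omega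
      exact_mod_cast h''
  · push Not at h1 h2
    constructor
    · by_contra hlt
      push Not at hlt
      have h : ⌈a⌉ ≤ n := Int.ceil_le.2 hlt.le
      have h' : (⌈a⌉ : ℝ) ≤ (n : ℝ) := by exact_mod_cast h
      linarith
    · by_contra hlt
      push Not at hlt
      have h : n + 1 ≤ ⌊a⌋ := Int.le_floor.2 (by push_cast; exact hlt.le)
      have h' : (n : ℝ) + 1 ≤ (⌊a⌋ : ℝ) := by exact_mod_cast h
      linarith

/-- The whisker endpoint f = `snap R p`: every coordinate of p rounded as in `snap1`. [folklore] -/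
def snap (R : ℝ) (p : RPt d) : RPt d := fun μ => snap1 R (p μ)

/-- |f − p|_∞ ≤ R. [folklore] -/
theorem dist_snap_le {R : ℝ} (hR : 0 ≤ R) (p : RPt d) : dist (snap R p) p ≤ R := by
  refine (dist_pi_le_iff hR).2 fun μ => ?_
  rw [Real.dist_eq]
  exact abs_snap1_sub_le hR (p μ)

/-- THE WHISKER LEMMA (sup metric, 2R < 1): every closed unit cube of the grid containing a point q with |q − p|_∞ ≤ R
contains the whisker endpoint `snap R p`. [folklore] -/
theorem snap_mem_cube {R : ℝ} (h2R : 2 * R < 1) {c : Pt d} {q p : RPt d} (hq : q ∈ cube c)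
    (hqp : dist q p ≤ R) : snap R p ∈ cube c := by
  rw [mem_cube] at hq ⊢
  intro μ
  have hμ : |q μ - p μ| ≤ R := by
    rw [← Real.dist_eq]
    exact (dist_le_pi_dist q p μ).trans hqp
  exact snap1_mem h2R (hq μ).1 (hq μ).2 hμ

/-! ## Part 3. The cells of Z′ versus the cubes of Z; "two scales apart" (GEOMETRY-236.md (F1) and Lemma 1) -/

/-- (F1) of GEOMETRY-236.md made quantitative in the rescaled picture: every cell c of Z′ = `closureIdx L (collar Z)`
contains a point q (the image under p ↦ p/L of a common corner of a cube y of Z̃ lying in the cell and a cube z of Z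
touching y) such that the image of EVERY point of the cube z is within 1/L of q. [folklore] -/
theorem exists_corner_point {L : ℕ} (hL : 0 < L) {Z : Finset (Pt d)} {c : Pt d}
    (hc : c ∈ closureIdx L (collar Z)) :
    ∃ z ∈ Z, ∃ q ∈ cube c, ∀ P ∈ cube z, dist q ((L : ℝ)⁻¹ • P) ≤ 1 / (L : ℝ) := by
  unfold closureIdx at hc
  rw [Finset.mem_image] at hc
  obtain ⟨y, hy, rfl⟩ := hc
  unfold collar at hy
  rw [Finset.mem_biUnion] at hy
  obtain ⟨z, hz, hyz⟩ := hy
  rw [mem_block] at hyz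
  have hLr : (0 : ℝ) < L := by exact_mod_cast hL
  set w : RPt d := fun i => max (y i : ℝ) (z i : ℝ) with hw
  have hwy : w ∈ cube y := by
    rw [mem_cube]
    intro i
    obtain ⟨h1, h2⟩ := hyz i
    have h1' : (z i : ℝ) - 1 ≤ (y i : ℝ) := by exact_mod_cast h1
    have h2' : (y i : ℝ) ≤ (z i : ℝ) + 1 := by exact_mod_cast h2
    exact ⟨le_max_left _ _, max_le (by linarith) (by linarith)⟩
  have hwz : w ∈ cube z := by
    rw [mem_cube]
    intro i
    obtain ⟨h1, h2⟩ := hyz i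
    have h1' : (z i : ℝ) - 1 ≤ (y i : ℝ) := by exact_mod_cast h1
    have h2' : (y i : ℝ) ≤ (z i : ℝ) + 1 := by exact_mod_cast h2
    exact ⟨le_max_right _ _, max_le h2' (by linarith)⟩
  refine ⟨z, hz, (L : ℝ)⁻¹ • w, smul_mem_cube_coarse hL hwy, fun P hP => ?_⟩
  rw [dist_smul₀, Real.norm_of_nonneg (inv_nonneg.2 hLr.le)]
  calc (L : ℝ)⁻¹ * dist w P ≤ (L : ℝ)⁻¹ * 1 :=
        mul_le_mul_of_nonneg_left (dist_le_one_of_mem_cube hwz hP) (inv_nonneg.2 hLr.le)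
    _ = 1 / L := by rw [mul_one, one_div]

/-- TWO SCALES APART (GEOMETRY-236.md Lemma 1, quantitative half): if two cells of Z′ are at index distance ≥ 2 in
some coordinate, then every admissible graph of Z has length ≥ L − 2 (it contains two points ≥ L − 2 apart in that
coordinate; pv22's capture lemma). [folklore] -/
theorem sub_two_le_len {L : ℕ} (hL : 3 ≤ L) {Z : Finset (Pt d)} {T : List (Seg d)} (hT : Admissible Z T)
    {c₁ c₂ : Pt d} (hc₁ : c₁ ∈ closureIdx L (collar Z)) (hc₂ : c₂ ∈ closureIdx L (collar Z))
    {μ : Fin d} (hfar : c₁ μ + 2 ≤ c₂ μ) : (L : ℝ) - 2 ≤ len T := by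
  have hL0 : 0 < L := by omega
  have hLr : (0 : ℝ) < L := by exact_mod_cast hL0
  have hLne : (L : ℝ) ≠ 0 := hLr.ne'
  have hL3 : (3 : ℝ) ≤ L := by exact_mod_cast hL
  obtain ⟨z₁, hz₁, q₁, hq₁, h₁⟩ := exists_corner_point hL0 hc₁
  obtain ⟨z₂, hz₂, q₂, hq₂, h₂⟩ := exists_corner_point hL0 hc₂
  obtain ⟨t₁, ht₁T, ht₁c⟩ := hT.meets z₁ hz₁
  obtain ⟨t₂, ht₂T, ht₂c⟩ := hT.meets z₂ hz₂
  have d₁ : |q₁ μ - (L : ℝ)⁻¹ * t₁ μ| ≤ 1 / L := by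
    have := (dist_le_pi_dist q₁ ((L : ℝ)⁻¹ • t₁) μ).trans (h₁ t₁ ht₁c)
    rwa [Real.dist_eq, Pi.smul_apply, smul_eq_mul] at this
  have d₂ : |q₂ μ - (L : ℝ)⁻¹ * t₂ μ| ≤ 1 / L := by
    have := (dist_le_pi_dist q₂ ((L : ℝ)⁻¹ • t₂) μ).trans (h₂ t₂ ht₂c)
    rwa [Real.dist_eq, Pi.smul_apply, smul_eq_mul] at this
  have hq₁μ : q₁ μ ≤ (c₁ μ : ℝ) + 1 := ((mem_cube.1 hq₁) μ).2
  have hq₂μ : (c₂ μ : ℝ) ≤ q₂ μ := ((mem_cube.1 hq₂) μ).1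
  have hfar' : (c₁ μ : ℝ) + 2 ≤ (c₂ μ : ℝ) := by exact_mod_cast hfar
  rw [abs_le] at d₁ d₂
  have key : (L : ℝ) - 2 ≤ t₂ μ - t₁ μ := by
    have b1 : (L : ℝ)⁻¹ * t₁ μ ≤ (c₁ μ : ℝ) + 1 + 1 / L := by linarith [d₁.1]
    have b2 : (c₂ μ : ℝ) - 1 / L ≤ (L : ℝ)⁻¹ * t₂ μ := by linarith [d₂.2]
    have b1' := mul_le_mul_of_nonneg_left b1 hLr.le
    have b2' := mul_le_mul_of_nonneg_left b2 hLr.le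
    have a1 : (L : ℝ) * ((L : ℝ)⁻¹ * t₁ μ) = t₁ μ := by rw [← mul_assoc, mul_inv_cancel₀ hLne, one_mul]
    have a2 : (L : ℝ) * ((L : ℝ)⁻¹ * t₂ μ) = t₂ μ := by rw [← mul_assoc, mul_inv_cancel₀ hLne, one_mul]
    have e3 : (L : ℝ) * ((c₁ μ : ℝ) + 1 + 1 / L) = L * (c₁ μ : ℝ) + L + 1 := by
      rw [mul_add, mul_add, mul_one, mul_one_div_cancel hLne]
    have e4 : (L : ℝ) * ((c₂ μ : ℝ) - 1 / L) = L * (c₂ μ : ℝ) - 1 := by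
      rw [mul_sub, mul_one_div_cancel hLne]
    rw [a1, e3] at b1'
    rw [a2, e4] at b2'
    have hmul : (L : ℝ) * 2 ≤ L * ((c₂ μ : ℝ) - (c₁ μ : ℝ)) :=
      mul_le_mul_of_nonneg_left (by linarith) hLr.le
    linarith
  have hdist : (L : ℝ) - 2 ≤ dist t₁ t₂ := by
    calc (L : ℝ) - 2 ≤ t₂ μ - t₁ μ := key
      _ ≤ |t₁ μ - t₂ μ| := by rw [abs_sub_comm]; exact le_abs_self _
      _ = dist (t₁ μ) (t₂ μ) := (Real.dist_eq _ _).symm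
      _ ≤ dist t₁ t₂ := dist_le_pi_dist t₁ t₂ μ
  have hρ : (0 : ℝ) < L - 2 := by linarith
  calc (L : ℝ) - 2 ≤ lenIn (Metric.closedBall t₁ ((L : ℝ) - 2)) T :=
        le_lenIn_closedBall hT.connected.isPreconnected ht₁T ht₂T hρ hdist
    _ ≤ len T := lenIn_le_len _ T

/-! ## Part 4. The whisker construction: an admissible graph for Z′ from one for Z -/

/-- THE CONSTRUCTION (GEOMETRY-236.md Theorem A, with the tree cutting and the tree median replaced by a separated
net): let T be admissible for Z with |T| ≥ L − 2, L ≥ 3, and 0 < r with 4r + 2/L < 1.  Then Z′ has an admissible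
graph T′ — the rescaled graph T/L plus one whisker of sup-length ≤ 2r + 1/L at each point of a maximal 2r-separated
net of rescaled witness points — with L·|T′| ≤ 3|T| + |T|/(rL). [folklore] -/
theorem exists_admissible_closure {L : ℕ} (hL : 3 ≤ L) {Z : Finset (Pt d)} {T : List (Seg d)}
    (hT : Admissible Z T) {r : ℝ} (hr : 0 < r) (hr1 : 4 * r + 2 / (L : ℝ) < 1)
    (hlen : (L : ℝ) - 2 ≤ len T) :
    ∃ T', Admissible (closureIdx L (collar Z)) T' ∧ (L : ℝ) * len T' ≤ 3 * len T + len T / (r * L) := by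
  classical
  have hL0 : 0 < L := by omega
  have hLr : (0 : ℝ) < L := by exact_mod_cast hL0
  have hLne : (L : ℝ) ≠ 0 := hLr.ne'
  have hL3 : (3 : ℝ) ≤ L := by exact_mod_cast hL
  -- witnesses of T in the cubes of Z and their images under p ↦ p/L
  have hw : ∀ z ∈ Z, ∃ w, w ∈ carrier T ∧ w ∈ cube z := fun z hz => by
    obtain ⟨w, hw⟩ := hT.meets z hz
    exact ⟨w, hw.1, hw.2⟩
  choose! P hPT hPc using hw
  set p : Pt d → RPt d := fun z => (L : ℝ)⁻¹ • P z with hp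
  set T₁ : List (Seg d) := T.map (scaleSeg (L : ℝ)⁻¹) with hT₁def
  have hT₁ : Admissible (closureIdx L Z) T₁ := admissible_scale hL0 hT
  have hlen₁ : len T₁ = (L : ℝ)⁻¹ * len T := len_map_scaleSeg (inv_nonneg.2 hLr.le) T
  have hpT₁ : ∀ z ∈ Z, p z ∈ carrier T₁ := fun z hz => by
    rw [hT₁def, carrier_map_scaleSeg]
    exact Set.mem_image_of_mem _ (hPT z hz)
  have hpc : ∀ z ∈ Z, p z ∈ cube (coarse L z) := fun z hz => smul_mem_cube_coarse hL0 (hPc z hz)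
  -- a maximal 2r-separated subfamily S of the rescaled witness points
  obtain ⟨S, hSmem, hSmax⟩ := (Z.powerset.filter fun S : Finset (Pt d) =>
      ∀ a ∈ S, ∀ b ∈ S, a ≠ b → 2 * r < dist (p a) (p b)).exists_max_image Finset.card ⟨∅, by simp⟩
  rw [Finset.mem_filter, Finset.mem_powerset] at hSmem
  obtain ⟨hSZ, hSsep⟩ := hSmem
  have hcover : ∀ z ∈ Z, ∃ s ∈ S, dist (p z) (p s) ≤ 2 * r := by
    intro z hz
    by_cases hzS : z ∈ S
    · exact ⟨z, hzS, by rw [dist_self]; positivity⟩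
    by_contra hfar
    push Not at hfar
    have hins : insert z S ∈ Z.powerset.filter fun S : Finset (Pt d) =>
        ∀ a ∈ S, ∀ b ∈ S, a ≠ b → 2 * r < dist (p a) (p b) := by
      rw [Finset.mem_filter, Finset.mem_powerset]
      refine ⟨Finset.insert_subset hz hSZ, ?_⟩
      intro a ha b hb hab
      rw [Finset.mem_insert] at ha hb
      rcases ha with rfl | ha <;> rcases hb with rfl | hb
      · exact absurd rfl hab
      · exact hfar b hb
      · rw [dist_comm]; exact hfar a ha
      · exact hSsep a ha b hb hab
    have hle := hSmax _ hins
    rw [Finset.card_insert_of_notMem hzS] at hle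
    omega
  -- the whisker radius R = 2r + 1/L < 1/2 and the whisker endpoints f s
  set R : ℝ := 2 * r + 1 / L with hRdef
  have hR0 : 0 ≤ R := by positivity
  have h2R : 2 * R < 1 := by
    have e : 2 * R = 4 * r + 2 / L := by rw [hRdef]; ring
    linarith
  set f : Pt d → RPt d := fun s => snap R (p s) with hf
  have hfp : ∀ s, dist (p s) (f s) ≤ R := fun s => by
    rw [dist_comm]
    exact dist_snap_le hR0 (p s)
  have hfc : ∀ s ∈ Z, f s ∈ cube (coarse L s) := fun s hs =>
    snap_mem_cube h2R (hpc s hs) (by rw [dist_self]; exact hR0)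
  -- the whiskers
  set W : List (Seg d) := S.toList.map fun s => (p s, f s) with hWdef
  have hWmem : ∀ sg ∈ W, ∃ s ∈ S, sg = (p s, f s) := fun sg hsg => by
    rw [hWdef, List.mem_map] at hsg
    obtain ⟨s, hs, rfl⟩ := hsg
    exact ⟨s, Finset.mem_toList.1 hs, rfl⟩
  have hmemW : ∀ s ∈ S, (p s, f s) ∈ W := fun s hs => by
    rw [hWdef, List.mem_map]
    exact ⟨s, Finset.mem_toList.2 hs, rfl⟩
  have hlenW : len W ≤ (S.card : ℝ) * R := by
    have := len_map_le S.toList (fun s => (p s, f s)) (fun s _ => hfp s)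
    rwa [Finset.length_toList] at this
  refine ⟨T₁ ++ W, ⟨?_, ?_, ?_⟩, ?_⟩
  · -- connected: each whisker hangs at a point p s of T₁
    rw [carrier_append]
    exact isConnected_union_carrier hT₁.connected W fun sg hsg => by
      obtain ⟨s, hs, rfl⟩ := hWmem sg hsg
      exact hpT₁ s (hSZ hs)
  · -- contained in the cubes of Z′ (T₁ in the cells met by Z; each whisker in the cell of its cube s, by convexity)
    rw [carrier_append]
    refine Set.union_subset
      (hT₁.subset.trans (cubes_mono (Finset.image_subset_image (subset_collar Z)))) ?_
    intro x hx
    obtain ⟨sg, hsg, hx⟩ := mem_carrier.1 hx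
    obtain ⟨s, hs, rfl⟩ := hWmem sg hsg
    have hsZ : s ∈ Z := hSZ hs
    have hcs : coarse L s ∈ closureIdx L (collar Z) := by
      unfold closureIdx
      exact Finset.mem_image_of_mem _ (subset_collar Z hsZ)
    exact cube_subset_cubes hcs ((convex_cube _).segment_subset (hpc s hsZ) (hfc s hsZ) hx)
  · -- meets every cell of Z′: the cell contains a point within R of some net point p s, hence contains f s
    intro c hc
    obtain ⟨z, hz, q, hqc, hq⟩ := exists_corner_point hL0 hc
    obtain ⟨s, hs, hzs⟩ := hcover z hz
    have hqs : dist q (p s) ≤ R := by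
      calc dist q (p s) ≤ dist q (p z) + dist (p z) (p s) := dist_triangle _ _ _
        _ ≤ 1 / L + 2 * r := add_le_add (hq (P z) (hPc z hz)) hzs
        _ = R := by rw [hRdef]; ring
    refine ⟨f s, ?_, snap_mem_cube h2R hqc hqs⟩
    rw [carrier_append]
    exact Or.inr (mem_carrier.2 ⟨(p s, f s), hmemW s hs, right_mem_segment ℝ (p s) (f s)⟩)
  · -- the length accounting
    rw [len_append, hlen₁]
    have e1 : (L : ℝ) * ((L : ℝ)⁻¹ * len T + len W) = len T + L * len W := by
      rw [mul_add, ← mul_assoc, mul_inv_cancel₀ hLne, one_mul]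
    rw [e1]
    have hLW : (L : ℝ) * len W ≤ 2 * ((S.card : ℝ) * (r * L)) + S.card := by
      calc (L : ℝ) * len W ≤ L * ((S.card : ℝ) * R) := mul_le_mul_of_nonneg_left hlenW hLr.le
        _ = 2 * ((S.card : ℝ) * (r * L)) + S.card := by
          rw [hRdef]
          field_simp
    have hrL : 0 < r * L := mul_pos hr hLr
    have hnn : 0 ≤ len T / (r * L) := div_nonneg (len_nonneg T) hrL.le
    rcases Nat.lt_or_ge 1 S.card with h1 | h1
    · -- two or more whiskers: the disjoint balls B̄(p s, r), s ∈ S, each capture length ≥ r of T₁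
      have hcap : ∀ s ∈ S, r ≤ lenIn (Metric.closedBall (p s) r) T₁ := by
        intro s hs
        obtain ⟨s', hs', hne⟩ := (Finset.one_lt_card_iff_nontrivial.1 h1).exists_ne s
        have hfar : r ≤ dist (p s) (p s') := by
          have := hSsep s hs s' hs' hne.symm
          linarith
        exact le_lenIn_closedBall hT₁.connected.isPreconnected (hpT₁ s (hSZ hs)) (hpT₁ s' (hSZ hs')) hr hfar
      have hdisj : (S : Set (Pt d)).PairwiseDisjoint (fun s => Metric.closedBall (p s) r) := by
        intro a ha b hb hab
        exact Metric.closedBall_disjoint_closedBall (by have := hSsep a ha b hb hab; linarith)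
      have hsum : (S.card : ℝ) * r ≤ len T₁ := by
        calc (S.card : ℝ) * r = ∑ s ∈ S, r := by rw [Finset.sum_const, nsmul_eq_mul]
          _ ≤ ∑ s ∈ S, lenIn (Metric.closedBall (p s) r) T₁ := Finset.sum_le_sum hcap
          _ ≤ len T₁ := sum_lenIn_le_len S _ (fun s _ => Metric.isClosed_closedBall) hdisj T₁
      rw [hlen₁] at hsum
      have hS : (S.card : ℝ) * (r * L) ≤ len T := by
        have h2 := mul_le_mul_of_nonneg_right hsum hLr.le
        have e2 : (L : ℝ)⁻¹ * len T * L = len T := by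
          field_simp
        calc (S.card : ℝ) * (r * L) = (S.card : ℝ) * r * L := by ring
          _ ≤ (L : ℝ)⁻¹ * len T * L := h2
          _ = len T := e2
      have hS' : (S.card : ℝ) ≤ len T / (r * L) := by
        rw [le_div_iff₀ hrL]
        exact hS
      linarith
    · -- at most one whisker: its cost 2rL + 1 < L/2 ≤ 2|T| since |T| ≥ L − 2
      have hc1 : (S.card : ℝ) ≤ 1 := by exact_mod_cast h1
      have h4 : 4 * (r * L) + 2 < L := by
        have h5 := mul_lt_mul_of_pos_right hr1 hLr
        have e : (4 * r + 2 / L) * (L : ℝ) = 4 * (r * L) + 2 := by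
          field_simp
        rwa [e, one_mul] at h5
      have h5 : (S.card : ℝ) * (r * L) ≤ r * L := by
        have := mul_le_mul_of_nonneg_right hc1 hrL.le
        rwa [one_mul] at this
      linarith

/-! ## Part 5. The theorem: L·d_{k+1}(Z′) ≤ (3 + 4/(L − 2))·d_k(Z) for `treeLen`, every d, every L ≥ 3 -/

/-- THE CERTIFIED SUBSTITUTE FOR (2.36) p. 19, PROVED for the formalised tree length: for every dimension d, every
L ≥ 3 and every localization domain Z (non-empty, face-connected), with Z′ = the π_{k+1}-cubes met by Z̃,
`L · treeLen Z′ ≤ (3 + 4/(L − 2)) · treeLen Z` — against the printed, unproved `L · d_{k+1}(Z′) ≤ 2 · d_k(Z)`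
(cell GAPS.md G-B13-09) and the prose constant 3 + 12/(L − 2) of GEOMETRY-236.md Corollary B. [cite: Balaban1988RG2Cluster, (2.36) p.19] -/
theorem geometry236_treeLen {L : ℕ} (hL : 3 ≤ L) {Z : Finset (Pt d)} (hZ : Z.Nonempty) (hc : FaceConnected Z) :
    (L : ℝ) * treeLen (closureIdx L (collar Z)) ≤ (3 + 4 / ((L : ℝ) - 2)) * treeLen Z := by
  have hL0 : 0 < L := by omega
  have hLr : (0 : ℝ) < L := by exact_mod_cast hL0
  have hL3 : (3 : ℝ) ≤ L := by exact_mod_cast hL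
  have hL2 : (0 : ℝ) < L - 2 := by linarith
  have htl0 : 0 ≤ treeLen Z := treeLen_nonneg Z
  have hK0 : (0 : ℝ) ≤ 3 + 4 / ((L : ℝ) - 2) := by positivity
  have hne' : (closureIdx L (collar Z)).Nonempty := closureIdx_nonempty (hZ.mono (subset_collar Z))
  by_cases hdeg : ∀ c₁ ∈ closureIdx L (collar Z), ∀ c₂ ∈ closureIdx L (collar Z), ∀ μ, c₂ μ ≤ c₁ μ + 1
  · -- all cells of Z′ pairwise touch: the one-point graph, treeLen Z′ = 0
    obtain ⟨q, hq⟩ := exists_common_point hne' hdeg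
    have h0 : treeLen (closureIdx L (collar Z)) ≤ 0 := by
      have := treeLen_le_len (admissible_point hne' hq)
      simpa using this
    calc (L : ℝ) * treeLen (closureIdx L (collar Z)) ≤ L * 0 := mul_le_mul_of_nonneg_left h0 hLr.le
      _ = 0 := mul_zero _
      _ ≤ (3 + 4 / ((L : ℝ) - 2)) * treeLen Z := mul_nonneg hK0 htl0
  · push Not at hdeg
    obtain ⟨c₁, hc₁, c₂, hc₂, μ, hμ⟩ := hdeg
    have hfar : c₁ μ + 2 ≤ c₂ μ := by omega
    have hne : ∃ T, Admissible Z T := by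
      obtain ⟨T, hT, -⟩ := exists_admissible hZ hc
      exact ⟨T, hT⟩
    -- for every net radius ρ = rL < (L − 2)/4:  L·treeLen Z′ ≤ (3 + 1/ρ)·treeLen Z
    have key : ∀ ρ : ℝ, 0 < ρ → 4 * ρ + 2 < L →
        (L : ℝ) * treeLen (closureIdx L (collar Z)) ≤ (3 + 1 / ρ) * treeLen Z := by
      intro ρ hρ hρL
      refine le_mul_treeLen (by positivity) hne fun T hT => ?_
      have hlen : (L : ℝ) - 2 ≤ len T := sub_two_le_len hL hT hc₁ hc₂ hfar
      have hr1 : 4 * (ρ / L) + 2 / (L : ℝ) < 1 := by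
        have e : 4 * (ρ / L) + 2 / (L : ℝ) = (4 * ρ + 2) / L := by ring
        rw [e, div_lt_one hLr]
        exact hρL
      obtain ⟨T', hT', hb⟩ := exists_admissible_closure hL hT (div_pos hρ hLr) hr1 hlen
      have e : ρ / L * L = ρ := by field_simp
      rw [e] at hb
      calc (L : ℝ) * treeLen (closureIdx L (collar Z)) ≤ L * len T' :=
            mul_le_mul_of_nonneg_left (treeLen_le_len hT') hLr.le
        _ ≤ 3 * len T + len T / ρ := hb
        _ = (3 + 1 / ρ) * len T := by ring
    rcases htl0.eq_or_lt with h0 | hpos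
    · -- treeLen Z = 0
      have h := key (((L : ℝ) - 2) / 8) (by positivity) (by linarith)
      rw [← h0, mul_zero] at h
      rw [← h0, mul_zero]
      exact h
    · -- treeLen Z > 0: let ρ ↑ (L − 2)/4
      have htne : treeLen Z ≠ 0 := hpos.ne'
      refine le_of_forall_pos_le_add fun ε hε => ?_
      set A : ℝ := 4 / ((L : ℝ) - 2) with hA
      have hA0 : 0 < A := by positivity
      have hB0 : 0 < ε / treeLen Z := div_pos hε hpos
      have hρ : 0 < 1 / (A + ε / treeLen Z) := by positivity
      have hρL : 4 * (1 / (A + ε / treeLen Z)) + 2 < L := by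
        have h1 : 1 / (A + ε / treeLen Z) < 1 / A := one_div_lt_one_div_of_lt hA0 (by linarith)
        have h2 : 1 / A = ((L : ℝ) - 2) / 4 := by rw [hA, one_div_div]
        linarith
      have h := key _ hρ hρL
      rw [one_div_one_div] at h
      have e : ε / treeLen Z * treeLen Z = ε := by field_simp
      calc (L : ℝ) * treeLen (closureIdx L (collar Z)) ≤ (3 + (A + ε / treeLen Z)) * treeLen Z := h
        _ = (3 + A) * treeLen Z + ε / treeLen Z * treeLen Z := by ring
        _ = (3 + A) * treeLen Z + ε := by rw [e]

/-- The certified transfer constant a(L) = 3 + 4/(L − 2) of this module (the factor in `geometry236_treeLen`); the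
printed claim is the constant 2, the prose GEOMETRY-236.md has 3 + 12/(L − 2) = `B13.Consts.aL`.  Not a printed
quantity (cell DIVERGENCE.md D-b13.9). [cite: Balaban1988RG2Cluster, (2.36) p.19] -/
def a236 (L : ℝ) : ℝ := 3 + 4 / (L - 2)

/-- a(L) > 0 for L > 2. [folklore] -/
theorem a236_pos {L : ℝ} (hL : 2 < L) : 0 < a236 L := by
  unfold a236
  have : 0 < L - 2 := by linarith
  positivity

/-- The kernel constant improves the prose one: 3 + 4/(L − 2) ≤ `B13.Consts.aL L` = 3 + 12/(L − 2) (L > 2), so every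
consequence drawn in `…B13` Part F from the transfer factor L/aL L holds a fortiori. [cite: Balaban1988RG2Cluster, (2.36) p.19] -/
theorem a236_le_aL {L : ℝ} (hL : 2 < L) : a236 L ≤ B13.Consts.aL L := by
  unfold a236 B13.Consts.aL
  have h2 : 0 < L - 2 := by linarith
  have h : 0 ≤ 8 / (L - 2) := by positivity
  have e : (12 : ℝ) / (L - 2) = 4 / (L - 2) + 8 / (L - 2) := by ring
  linarith

/-- a(13) = 37/11 (L = 13 is the least block size admitted by [Balaban1987RG1] p. 251, cell SMALLNESS.md S-B12.1;
prose: 45/11). [cite: Balaban1988RG2Cluster, (2.36) p.19] -/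
theorem a236_thirteen : a236 13 = 37 / 11 := by norm_num [a236]

/-- a(L) < L for L ≥ 5 (indeed iff L > (5 + √17)/2 = 4.56…; a(3) = 7, a(4) = 5): the transfer factor L/a(L) exceeds 1,
so the p. 21 closing assumption `(1 − 10δ)·(L/a(L)) = 1` has a solution δ ∈ (0, 1/10) (`B13.Consts.delta_bounds_of_R22gen`)
for every L admitted by [Balaban1987RG1] p. 251. [cite: Balaban1988RG2Cluster, p.21 (after (2.41))] -/
theorem a236_lt_self {L : ℝ} (hL : 5 ≤ L) : a236 L < L := by
  unfold a236
  have h2 : 0 < L - 2 := by linarith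
  rw [← sub_pos]
  have e : L - (3 + 4 / (L - 2)) = (L ^ 2 - 5 * L + 2) / (L - 2) := by
    field_simp
    ring
  rw [e]
  apply div_pos _ h2
  nlinarith [mul_nonneg (by linarith : (0 : ℝ) ≤ L) (by linarith : (0 : ℝ) ≤ L - 5)]

/-- The certified transfer factor ℓ = L/a(L) exceeds 1 for L ≥ 5. [cite: Balaban1988RG2Cluster, p.21 (after (2.41))] -/
theorem one_lt_transferFactor {L : ℝ} (hL : 5 ≤ L) : 1 < L / a236 L := by
  have ha : 0 < a236 L := a236_pos (by linarith)
  rw [lt_div_iff₀ ha, one_mul]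
  exact a236_lt_self hL

/-- At L = 13 the certified transfer factor is 13/a(13) = 143/37 = 3.86… (printed ½L = 6.5; prose 143/45 = 3.17…),
whence δ = (1 − 37/143)/10 = 53/715 = 0.0741… in `(1 − 10δ)ℓ = 1` (printed (1 − 2/13)/10 = 0.0846…). [cite: Balaban1988RG2Cluster, p.21 (after (2.41))] -/
theorem transferFactor_thirteen : (13 : ℝ) / a236 13 = 143 / 37 := by
  rw [a236_thirteen]
  norm_num

/-- THE THEOREM IN pv11's SHAPE: `ScaleTransfer d L treeLen (a236 L) 0` — multiplicative constant 3 + 4/(L − 2),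
additive constant 0 — for every d and every L ≥ 3 (kernel predecessors: `TreeLength.scaleTransfer_treeLen` with
(A_d, B_d) = (1 + 8(3^d − 1)(2^d + 1), 4(3^d − 1)(2^d + 1)), `scaleTransfer_treeLen_four` with (5121, 1280)). [cite: Balaban1988RG2Cluster, (2.36) p.19] -/
theorem scaleTransfer_treeLen_geometry {L : ℕ} (hL : 3 ≤ L) :
    ScaleTransfer d L (treeLen (d := d)) (a236 L) 0 := by
  intro Z hZ hc
  rw [add_zero]
  exact geometry236_treeLen hL hZ hc

/-- … hence also with the prose constant of GEOMETRY-236.md Corollary B: `ScaleTransfer d L treeLen (B13.Consts.aL L) 0`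
for every d and L ≥ 3 (Corollary B states d = 4). [cite: Balaban1988RG2Cluster, (2.36) p.19] -/
theorem scaleTransfer_treeLen_aL {L : ℕ} (hL : 3 ≤ L) :
    ScaleTransfer d L (treeLen (d := d)) (B13.Consts.aL L) 0 := by
  intro Z hZ hc
  have hL3 : (3 : ℝ) ≤ L := by exact_mod_cast hL
  have h := geometry236_treeLen hL hZ hc
  have ha : a236 (L : ℝ) ≤ B13.Consts.aL L := a236_le_aL (by linarith)
  have h' := mul_le_mul_of_nonneg_right ha (treeLen_nonneg Z)
  rw [add_zero]
  exact h.trans h'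

/-- d = 4, L = 13 (the least admitted block size): 13 · d_{k+1}(Z′) ≤ (37/11) · d_k(Z) for every localization domain
Z ⊂ ℤ⁴. [cite: Balaban1988RG2Cluster, (2.36) p.19] -/
theorem geometry236_thirteen {Z : Finset (Pt 4)} (hZ : Z.Nonempty) (hc : FaceConnected Z) :
    (13 : ℝ) * treeLen (closureIdx 13 (collar Z)) ≤ 37 / 11 * treeLen Z := by
  have h := geometry236_treeLen (d := 4) (L := 13) (by norm_num) hZ hc
  norm_num at h
  linarith

/-- The exponential form used on pp. 19–20 ((2.36) ⇒ (2.37): *"(1 − 5δ)κd_k(Z_i) in the exponentials replaced by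
(1 − 6δ)½Lκd_{k+1}(Z′_i)"*, here with L/a(L) in place of ½L and no constant): for every rate c ≥ 0,
`exp(−c·d_k(Z)) ≤ exp(−c·(L/a(L))·d_{k+1}(Z′))`. [cite: Balaban1988RG2Cluster, p.20 (after (2.36))] -/
theorem exp_transfer_geometry {L : ℕ} (hL : 3 ≤ L) {Z : Finset (Pt d)} (hZ : Z.Nonempty) (hc : FaceConnected Z)
    {c : ℝ} (hc0 : 0 ≤ c) :
    Real.exp (-(c * treeLen Z)) ≤
      Real.exp (-(c * ((L : ℝ) / a236 L) * treeLen (closureIdx L (collar Z)))) := by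
  have hL3 : (3 : ℝ) ≤ L := by exact_mod_cast hL
  have ha : 0 < a236 (L : ℝ) := a236_pos (by linarith)
  have h := geometry236_treeLen hL hZ hc
  have h' : (L : ℝ) / a236 L * treeLen (closureIdx L (collar Z)) ≤ treeLen Z := by
    rw [div_mul_eq_mul_div, div_le_iff₀ ha]
    calc (L : ℝ) * treeLen (closureIdx L (collar Z)) ≤ (3 + 4 / ((L : ℝ) - 2)) * treeLen Z := h
      _ = treeLen Z * a236 L := by unfold a236; ring
  apply Real.exp_le_exp.mpr
  have := mul_le_mul_of_nonneg_left h' hc0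
  rw [← mul_assoc] at this
  linarith

/-! ## Part 6. The transfer inequality `B13.Ineq236With` for pv22's concrete window systems, as a theorem -/

/-- X̃ is monotone in X. [folklore] -/
theorem collar_mono {S S' : Finset (Pt d)} (h : S ⊆ S') : collar S ⊆ collar S' := by
  intro y hy
  unfold collar at hy ⊢
  rw [Finset.mem_biUnion] at hy ⊢
  obtain ⟨z, hz, hyz⟩ := hy
  exact ⟨z, h hz, hyz⟩

/-- Z ↦ (the π_{k+1}-cubes met by Z) is monotone. [folklore] -/
theorem closureIdx_mono (L : ℕ) {S S' : Finset (Pt d)} (h : S ⊆ S') : closureIdx L S ⊆ closureIdx L S' := by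
  unfold closureIdx
  exact Finset.image_subset_image h

/-- THE CLOSURE MAP Z ↦ Z′ = *"the smallest localization domain from 𝐃_{k+1} containing Z̃"* (p. 19) between pv22's
concrete systems of localization domains: from the domains of a window B_k (scale k) to those of any window B_{k+1}
(scale k + 1, rescaled) containing (B̃_k)′; Z′ is non-empty and face-connected by pv11's `faceConnected_closure`. [cite: Balaban1988RG2Cluster, p.19 (definition of Z′)] -/
def closureDom {L : ℕ} (hL : 0 < L) {Bk Bk1 : Finset (Pt d)} (hB : closureIdx L (collar Bk) ⊆ Bk1)
    (X : TreeLengthCubeSystem.Dom Bk) : TreeLengthCubeSystem.Dom Bk1 :=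
  ⟨closureIdx L (collar X.1),
    ⟨(closureIdx_mono L (collar_mono X.2.1)).trans hB, closureIdx_nonempty (X.2.2.1.mono (subset_collar X.1)),
      faceConnected_closure hL X.2.2.2⟩⟩

/-- The closure map sends X to the index set Z′ of `geometry236_treeLen`. [folklore] -/
@[simp] theorem closureDom_val {L : ℕ} (hL : 0 < L) {Bk Bk1 : Finset (Pt d)} (hB : closureIdx L (collar Bk) ⊆ Bk1)
    (X : TreeLengthCubeSystem.Dom Bk) : (closureDom hL hB X).1 = closureIdx L (collar X.1) := rfl

/-- (2.36)_ℓ AS A THEOREM for the concrete carrier: for pv22's window systems `sys B_k`, `sys B_{k+1}` (d_j := `treeLen`)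
and the closure map Z ↦ Z′, b13's transfer hypothesis `B13.Ineq236With (sys B_k) (sys B_{k+1}) (Z ↦ Z′) ℓ` HOLDS with
ℓ = L / a236 L, every d, every L ≥ 3 — the input of `B13.exp_transfer_of_ineq236With` (the ℓ at which
`B13.Lemma3With` / `B13.Consts.R22gen` / `B13Closing.deliverables_window` are to be run) supplied by a kernel theorem
instead of the printed, unproved ℓ = ½L. [cite: Balaban1988RG2Cluster, (2.36) p.19] -/
theorem ineq236With_window {L : ℕ} (hL : 3 ≤ L) {Bk Bk1 : Finset (Pt d)} (hB : closureIdx L (collar Bk) ⊆ Bk1) :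
    B13.Ineq236With (TreeLengthCubeSystem.sys Bk) (TreeLengthCubeSystem.sys Bk1)
      (closureDom (by omega : 0 < L) hB) ((L : ℝ) / a236 L) := by
  have hL3 : (3 : ℝ) ≤ L := by exact_mod_cast hL
  refine B13.ineq236With_of_pointwise (a236_pos (by linarith)) fun X => ?_
  show (L : ℝ) * treeLen (closureIdx L (collar X.1)) ≤ a236 L * treeLen X.1
  exact geometry236_treeLen hL X.2.2.1 X.2.2.2

/-- The natural choice of the next window: B_{k+1} := (B̃_k)′ itself. [folklore] -/
theorem ineq236With_window_self {L : ℕ} (hL : 3 ≤ L) (Bk : Finset (Pt d)) :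
    B13.Ineq236With (TreeLengthCubeSystem.sys Bk) (TreeLengthCubeSystem.sys (closureIdx L (collar Bk)))
      (closureDom (by omega : 0 < L) subset_rfl) ((L : ℝ) / a236 L) :=
  ineq236With_window hL subset_rfl

end

end Literature.MathematicalPhysics.QuantumFieldTheory.Balaban1983to89.B13Geometry236
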